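import Literature.Geometry.ComplexAnalytic.CyclicNodePencilRadiusSaturated
import Literature.AlgebraicGeometry.Motives.UniversalHypersurfaceRegularLocusChartFunction
import Literature.AlgebraicGeometry.Motives.UniversalHypersurfaceRegularLocusChartPartial
import HarnessLib

/-!
# The saturated Morse radius on `𝒴°(ℂ)`

Family `hodge`, layer `Literature/AlgebraicGeometry/HodgeTheory`; step A2c(ii) of the programme discharging
`HodgeTheory/CyclicCoverNodalMeridianLocalMonodromyBound`. The function `F = R'' − regChartExtend 2 p 2 (κ ∘ y)` (`κ = radiusDefect Θ R''' R''` of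
`Geometry/ComplexAnalytic/CyclicNodePencilRadiusSaturated`) is `C^∞` on `𝒴°(ℂ)`, equals `R''` off the chart `x₂ ≠ 0`, equals the Morse radius
`Σ|Θ(y(Q))|²` wherever this is `≤ R'''`, and its values `< R'''` are taken only at such points; near them it agrees (as a germ) with the cut-off
radius `ρ̃ = regChartExtend 2 p 2 (morseRadiusCutoff Θ R''' R'' ∘ y)`, so the two have the same differential there. `F` is the slab function of
the first-integral argument (`Geometry/Manifold/IntegralCurveSlab`) showing that the cut-off monodromy flows preserve the outside of the Morse ball.

* `satRadius`, `satRadius_of_not_mem`, `satRadius_of_mem`, `contMDiff_satRadius`;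
* `mem_of_satRadius_lt` — `F(Q) < R''' ⇒ Q ∈ 𝒴°(ℂ)₂ ∧ y(Q) ∈ Θ.source ∧ Σ|Θ y(Q)|² = F(Q)`; `satRadius_eq_of_le`;
* `satRadius_eventuallyEq_cutoffRadius`, `mfderiv_satRadius_eq` — agreement with `ρ̃` near the inner region.

Everything is proved; the one definition is concrete; no named facts.

## References

* [ArnoldGuseinzadeVarchenko2012] V. I. Arnold, S. M. Gusein-Zade, A. N. Varchenko, Singularities of Differentiable Maps II (2012), Part I §1.1, §2.1.
* [BrockerJanichIDT1982] T. Bröcker, K. Jänich, Introduction to Differential Topology (1982), §7.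
-/

noncomputable section

open CategoryTheory AlgebraicGeometry TopologicalSpace Set Topology Filter
open scoped Manifold ContDiff
open Literature.AlgebraicGeometry.Motives Literature.AlgebraicGeometry.Motives.UniversalHypersurface
open Literature.Geometry.ComplexAnalytic

namespace Literature.AlgebraicGeometry.HodgeTheory

variable (p : ℕ) (Θ : OpenPartialHomeomorph (Fin (1 + 2) → ℂ) (Fin (1 + 2) → ℂ)) (R''' R'' : ℝ)

/-- **The saturated Morse radius** `F(Q) = R'' − regChartExtend 2 p 2 (κ ∘ y) Q`. [cite: ArnoldGuseinzadeVarchenko2012, Part I §2.1] -/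
def satRadius (Q : ComplexPoints (regularTotal ℂ 2 p)) : ℝ :=
  R'' - regChartExtend 2 p 2 (fun v => PhamBrieskorn.radiusDefect Θ R''' R'' (fun j => v (Sum.inr j))) Q

/-- Off the chart domain `F = R''`. [cite: ArnoldGuseinzadeVarchenko2012, Part I §2.1] -/
theorem satRadius_of_not_mem {Q : ComplexPoints (regularTotal ℂ 2 p)} (hQ : Q ∉ regChartDom 2 p 2) :
    satRadius p Θ R''' R'' Q = R'' := by
  rw [satRadius, regChartExtend_of_not_mem 2 p 2 _ hQ, sub_zero]

/-- On the chart domain `F = R'' − κ(y(Q))`. [cite: ArnoldGuseinzadeVarchenko2012, Part I §2.1] -/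
theorem satRadius_of_mem {Q : ComplexPoints (regularTotal ℂ 2 p)} (hQ : Q ∈ regChartDom 2 p 2) :
    satRadius p Θ R''' R'' Q =
      R'' - PhamBrieskorn.radiusDefect Θ R''' R'' (fun j => regChartFun 2 p 2 Q (Sum.inr j)) := by
  rw [satRadius, regChartExtend_of_mem 2 p 2 _ hQ]

/-- **`F` is `C^∞` on `𝒴°(ℂ)`** (`p ≥ 1`, `Θ` smooth on its source, `R''' < R''`, `{Σ|z|² ≤ R''} ⊆ Θ.target`).
[cite: BrockerJanichIDT1982, §7] -/
theorem contMDiff_satRadius (hd : 0 < p) (hΘ : ContDiffOn ℝ ∞ Θ Θ.source) (hR : R''' < R'')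
    (hR'' : {z : Fin (1 + 2) → ℂ | ∑ i, ‖z i‖ ^ 2 ≤ R''} ⊆ Θ.target) :
    haveI := locallyOfFiniteType_regularTotal_hom ℂ 2 p hd
    haveI := smoothOfRelativeDimension_regularTotal_hom ℂ 2 p hd
    letI := ComplexPoints.chartedSpace (regularTotal ℂ 2 p) (2 + Fintype.card (DegIndex 2 p))
    ContMDiff (𝓡 (2 * (2 + Fintype.card (DegIndex 2 p)))) 𝓘(ℝ, ℝ) ∞ (satRadius p Θ R''' R'') := by
  haveI := locallyOfFiniteType_regularTotal_hom ℂ 2 p hd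
  haveI := smoothOfRelativeDimension_regularTotal_hom ℂ 2 p hd
  letI := ComplexPoints.chartedSpace (regularTotal ℂ 2 p) (2 + Fintype.card (DegIndex 2 p))
  have hlin : ContDiff ℝ ∞ (fun v : ChartIdx 2 p 2 → ℂ => (fun j : Fin (2 + 1) => v (Sum.inr j))) :=
    contDiff_pi.2 fun j => contDiff_apply ℝ ℂ (Sum.inr j : ChartIdx 2 p 2)
  have hB : ContDiff ℝ ∞ (fun v : ChartIdx 2 p 2 → ℂ => PhamBrieskorn.radiusDefect Θ R''' R'' (fun j => v (Sum.inr j))) :=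
    (PhamBrieskorn.contDiff_radiusDefect Θ R''' R'' hΘ hR hR'').comp hlin
  obtain ⟨R, hRb⟩ := PhamBrieskorn.exists_bound_radiusDefect Θ R''' R'' hR hR''
  have hBR : ∀ v : ChartIdx 2 p 2 → ℂ, R < ‖fun j => v (Sum.inr j)‖ →
      PhamBrieskorn.radiusDefect Θ R''' R'' (fun j => v (Sum.inr j)) = 0 := fun v hv => hRb _ hv
  exact contMDiff_const.sub (contMDiff_regChartExtend_real 2 p 2 hd _ hB hBR)

/-- **Small values of `F` detect the inner Morse region**: `F(Q) < R'''` (`R''' < R''`) implies `Q ∈ 𝒴°(ℂ)₂`, `y(Q) ∈ Θ.source` and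
`Σ|Θ(y(Q))|² = F(Q)`. [cite: ArnoldGuseinzadeVarchenko2012, Part I §2.1] -/
theorem mem_of_satRadius_lt (hR : R''' < R'') {Q : ComplexPoints (regularTotal ℂ 2 p)} (hlt : satRadius p Θ R''' R'' Q < R''') :
    Q ∈ regChartDom 2 p 2 ∧ (fun j => regChartFun 2 p 2 Q (Sum.inr j)) ∈ Θ.source ∧
      ∑ i, ‖Θ (fun j => regChartFun 2 p 2 Q (Sum.inr j)) i‖ ^ 2 = satRadius p Θ R''' R'' Q := by
  have hQ : Q ∈ regChartDom 2 p 2 := by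
    by_contra h
    rw [satRadius_of_not_mem p Θ R''' R'' h] at hlt
    exact absurd hlt (not_lt.mpr hR.le)
  rw [satRadius_of_mem p Θ R''' R'' hQ] at hlt ⊢
  exact ⟨hQ, PhamBrieskorn.lt_of_sub_radiusDefect_lt Θ R''' R'' hR hlt⟩

/-- **On the inner region `F` is the Morse radius**: `Q ∈ 𝒴°(ℂ)₂`, `y(Q) ∈ Θ.source`, `Σ|Θ y(Q)|² ≤ R'''` ⇒ `F(Q) = Σ|Θ y(Q)|²`.
[cite: ArnoldGuseinzadeVarchenko2012, Part I §2.1] -/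
theorem satRadius_eq_of_le (hR : R''' < R'') {Q : ComplexPoints (regularTotal ℂ 2 p)} (hQ : Q ∈ regChartDom 2 p 2)
    (hy : (fun j => regChartFun 2 p 2 Q (Sum.inr j)) ∈ Θ.source)
    (hle : ∑ i, ‖Θ (fun j => regChartFun 2 p 2 Q (Sum.inr j)) i‖ ^ 2 ≤ R''') :
    satRadius p Θ R''' R'' Q = ∑ i, ‖Θ (fun j => regChartFun 2 p 2 Q (Sum.inr j)) i‖ ^ 2 := by
  rw [satRadius_of_mem p Θ R''' R'' hQ, PhamBrieskorn.radiusDefect_of_le Θ R''' R'' hR hy hle]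
  ring

/-- **Near the inner region `F` agrees with the cut-off radius `ρ̃`** (both are the Morse radius there): at `Q ∈ 𝒴°(ℂ)₂` with
`y(Q) ∈ Θ.source`, `Σ|Θ y(Q)|² < R'''` (`p ≥ 1`, `R''' < R''`),
`F =ᶠ[𝓝 Q] regChartExtend 2 p 2 (morseRadiusCutoff Θ R''' R'' ∘ y)`. [cite: ArnoldGuseinzadeVarchenko2012, Part I §2.1] -/
theorem satRadius_eventuallyEq_cutoffRadius (hd : 0 < p) (hR : R''' < R'') {Q : ComplexPoints (regularTotal ℂ 2 p)}
    (hQ : Q ∈ regChartDom 2 p 2) (hy : (fun j => regChartFun 2 p 2 Q (Sum.inr j)) ∈ Θ.source)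
    (hlt : ∑ i, ‖Θ (fun j => regChartFun 2 p 2 Q (Sum.inr j)) i‖ ^ 2 < R''') :
    haveI := locallyOfFiniteType_regularTotal_hom ℂ 2 p hd
    haveI := smoothOfRelativeDimension_regularTotal_hom ℂ 2 p hd
    letI := ComplexPoints.chartedSpace (regularTotal ℂ 2 p) (2 + Fintype.card (DegIndex 2 p))
    satRadius p Θ R''' R'' =ᶠ[𝓝 Q]
      regChartExtend 2 p 2 (fun v => PhamBrieskorn.morseRadiusCutoff Θ R''' R'' (fun j => v (Sum.inr j))) := by
  haveI := locallyOfFiniteType_regularTotal_hom ℂ 2 p hd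
  haveI := smoothOfRelativeDimension_regularTotal_hom ℂ 2 p hd
  letI := ComplexPoints.chartedSpace (regularTotal ℂ 2 p) (2 + Fintype.card (DegIndex 2 p))
  -- continuity of `y` at `Q`
  have hyc : ContinuousAt (fun Q' : ComplexPoints (regularTotal ℂ 2 p) => fun j => regChartFun 2 p 2 Q' (Sum.inr j)) Q := by
    have h1 : ContinuousAt (regChartFun 2 p 2) Q := (contMDiffAt_regChartFun 2 p 2 hd hQ).continuousAt
    exact (continuous_pi fun j => continuous_apply (Sum.inr j)).continuousAt.comp h1
  have hev1 := PhamBrieskorn.sub_radiusDefect_eventuallyEq Θ R''' R'' hR hy hlt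
  have hev2 := PhamBrieskorn.morseRadiusCutoff_eventuallyEq Θ R''' R'' hR hy hlt
  have hev : (fun y => R'' - PhamBrieskorn.radiusDefect Θ R''' R'' y) =ᶠ[𝓝 (fun j => regChartFun 2 p 2 Q (Sum.inr j))]
      PhamBrieskorn.morseRadiusCutoff Θ R''' R'' := hev1.trans hev2.symm
  have hpull := hev.comp_tendsto hyc
  filter_upwards [hpull, (isOpen_regChartDom 2 p 2).mem_nhds hQ] with Q' hQ' hQ'dom
  rw [satRadius_of_mem p Θ R''' R'' hQ'dom, regChartExtend_of_mem 2 p 2 _ hQ'dom]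
  exact hQ'

/-- **Hence `F` and `ρ̃` have the same differential near the inner region.** [cite: ArnoldGuseinzadeVarchenko2012, Part I §2.1] -/
theorem mfderiv_satRadius_eq (hd : 0 < p) (hR : R''' < R'') {Q : ComplexPoints (regularTotal ℂ 2 p)}
    (hQ : Q ∈ regChartDom 2 p 2) (hy : (fun j => regChartFun 2 p 2 Q (Sum.inr j)) ∈ Θ.source)
    (hlt : ∑ i, ‖Θ (fun j => regChartFun 2 p 2 Q (Sum.inr j)) i‖ ^ 2 < R''') :
    haveI := locallyOfFiniteType_regularTotal_hom ℂ 2 p hd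
    haveI := smoothOfRelativeDimension_regularTotal_hom ℂ 2 p hd
    letI := ComplexPoints.chartedSpace (regularTotal ℂ 2 p) (2 + Fintype.card (DegIndex 2 p))
    mfderiv (𝓡 (2 * (2 + Fintype.card (DegIndex 2 p)))) 𝓘(ℝ, ℝ) (satRadius p Θ R''' R'') Q =
      mfderiv (𝓡 (2 * (2 + Fintype.card (DegIndex 2 p)))) 𝓘(ℝ, ℝ)
        (regChartExtend 2 p 2 (fun v => PhamBrieskorn.morseRadiusCutoff Θ R''' R'' (fun j => v (Sum.inr j)))) Q := by
  haveI := locallyOfFiniteType_regularTotal_hom ℂ 2 p hd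
  haveI := smoothOfRelativeDimension_regularTotal_hom ℂ 2 p hd
  letI := ComplexPoints.chartedSpace (regularTotal ℂ 2 p) (2 + Fintype.card (DegIndex 2 p))
  exact (satRadius_eventuallyEq_cutoffRadius p Θ R''' R'' hd hR hQ hy hlt).mfderiv_eq

end Literature.AlgebraicGeometry.HodgeTheory

end
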